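import Literature.MathematicalPhysics.QuantumFieldTheory.Balaban1983to89.B9Thm314GpFlatHolder
import Literature.MathematicalPhysics.QuantumFieldTheory.Balaban1983to89.B6Prop22DualHolderMultiLevelTorus

/-!
# `Balaban1983to89.B9Thm314GpFlatDualHolder` — [B9] THEOREM 3.14 (pp. 426–427, (3.154)) AT `U = 1` ON THE GENUINE
`k`-LEVEL TORUS: THE DUAL HÖLDER ENTRY [4] (2.67)₅ = [B9] (3.43)₂ OF THE SCALAR PROPAGATOR `G′ = Δ′_a⁻¹` — for two nested
families `{Ω_j}`, `{Ω′_j}` on one torus, `Ω = Ω_k ∩ Ω′_k`, a common top block `B^k(y) ∋ x ≠ x′`, `supp λ ⊂ B^k(y′)`,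
`0 ≤ α < 1`:
`|x′ − x|_T^{−α}·|((G′[Ω] − G′[Ω′])∇_μ*λ)(x′) − ((G′[Ω] − G′[Ω′])∇_μ*λ)(x)| ≤ C·(L^k)^{1−α}·e^{−δ·min(d_Ω,d_Ω′)(y,y′)}·e^{−δ·d(y,y′,Ω)}·|λ|`
(no existing module is touched; no fact is minted)

FRAMING (verbatim cell line):
statement-level skeleton of published theorems with citation tags; proofs where landed; nothing here is a claim about the Yang–Mills mass gap

Sources under audit (cell pub-balaban / lit-balaban): T. Bałaban, *Propagators for lattice gauge theories in a
background field*, Commun. Math. Phys. **99** (1985) 389–434 [`Balaban1985BackgroundPropagators`, "B9"], pp. 426–427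
[PDF 38–39] (Theorem 3.14, (3.154)), p. 398 (3.43) (held text `paper:balaban1985-cmp99-background-propagators`
p0010/p0038/p0039); T. Bałaban, *Propagators and renormalization transformations for lattice gauge theories. II*, Commun.
Math. Phys. **96** (1984) 223–250 [`Balaban1984PropagatorsII`, "[4]"], Prop. 2.2 (2.67) p. 234 (second, third and fifth
entries).  Unit `lit-balaban-p21` (Phase-2 proof seat p21 gen 18, HOME `run/shared/lean/pub/lit-balaban/`, free-target
protocol G.5-34(d); B9 fold owner r06, B6 fold owner r03, referee ref-4).

## WHAT IS PRINTED

B9 Theorem 3.14 (p. 427): «… their difference satisfies all the inequalities characteristic for operators of the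
considered type, with the additional factor exp(−δ₀d(y, y′, Ω)) … (3.154)».  The Hölder members of Theorem 3.1 are (3.43)
p. 398: «‖ζ∇_UG′(U)λ‖_β, ‖ζG′(U)∇*_Uλ‖_β ≤ B₀(β)(Lʲη)^{1−β}e^{−δ₀d(y,y′)}|λ|, β₀ < 1, ζ ∈ C₀^∞(Δ̃(y)), y ∈ Λ_j,
supp λ ⊂ Δ(y′)» = [4] (2.67) p. 234, fifth entry for `G′∇*`.

## WHAT THIS FILE CERTIFIES (kernel-checked; lattice units; setting of files 1–5 `B9Thm314GpFlat…`)

* §1 `tele_le` — telescoping of a symmetric subadditive pair functional along a monotone lattice path of an order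
  interval (mirrors the private device of `B6Prop22HolderTwoLevelBox`); `blockBox` — a top block `B^k(y)` of `𝔅[D]` IS
  an order interval of side `L^k` of the fundamental box, all of whose sites belong to the block; `diffFun` — the functional
  `u ↦ c·((Gu)(x′) − (Gu)(x))`; **`abs_diffFun_le`** — its block bound on a top block from the `∇G′` majorant (2.67)₂ of
  ALL directions: `|x′−x|_T^{−α}·|(G′u)(x′) − (G′u)(x)| ≤ (d+1)·C₂·(L^k)^{1−α}·L^k·e^{−δd(y,b)}·B` for `supp u ⊂ B(b)`,
  `|u| ≤ B`, `x ≠ x′ ∈ B^k(y)` (the difference is a sum of `≤ (d+1)|x′−x|` nearest-neighbour differences inside the block,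
  `|x′−x|_T < L^k`).
* §2 **`thm314_Gpd_holder_flat_multiLevelTorus`** — for `0 ≤ α < 1` there are `δ, C, M₀ > 0`, `N₀ ≥ 1` (`k`-uniform,
  uniform in `μ`, independent of the two families) such that for all admissible data, `x ≠ x′` in a common TOP block `y`,
  `supp λ ⊂ B^k(y′)` (`|λ| ≤ B`):
  `|x′−x|_T^{−α}·|((G′[D] − G′[D′])∇_μ*λ)(x′) − ((G′[D] − G′[D′])∇_μ*λ)(x)| ≤ C·(L^k)^{1−α}·e^{−δ·min(d_D,d_{D′})(y,y′)}·e^{−δ·d(y,y′,Ω)}·B`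
  — inputs BY NAME: the torus dual Hölder entry `B6Prop22DualHolderMultiLevelTorus.prop22_fifth_multiLevelTorus` for
  BOTH families (trivial bound), the torus (2.67)₂ `prop22_second_multiLevelTorus` (block bound of `diffFun` on `G′[D]`),
  the torus (2.67)₃ `prop22_third_multiLevelTorus` (inner factor `G′[D′]∇_μ*`, weight exponent `1`), file 5's
  `fun_resolvent_bound`, file 3's `combined_bound`/`consts_260_261`/`weights_repair`.

## HONEST SCOPE

* `U = 1` only, the operator `G′` only, the dual Hölder member only ([4] (2.67)₅; B9 (3.43) second member, with B9's
  `ζ`-localised Hölder norm read as the Hölder quotient over two points of one block, as in the torus lineage); with files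
  3–5 all six entries of [4] (2.67) are now certified for the difference; not the `L²` members (3.46), not the mixed
  members (3.44)–(3.45), not the other operators.  Torus lineage setting (`Ω₁ = T_η`, levels `1 … k`, `A = 0`, `m² = 0`,
  lattice units, `P_μ ≥ 4`); (3.154) = file 1's `dOmega`; the characteristic factor carries `min(d_D, d_{D′})`; constants
  depend on `α`.  A different (resolvent) proof of the printed statement on a model family, declared; nothing is inferred
  from the manuscript: every step is kernel-checked; the quoted sentences locate the statements.
-/

namespace Literature.MathematicalPhysics.QuantumFieldTheory.Balaban1983to89.B9Thm314GpFlatDualHolder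

open Finset Matrix
open Literature.MathematicalPhysics.QuantumFieldTheory.Balaban1983to89.B4ContourShift (supNorm supNorm_nonneg
  abs_le_supNorm exists_supNorm_eq)
open Literature.MathematicalPhysics.QuantumFieldTheory.Balaban1983to89.B4Reflection242 (boxDom mem_boxDom blk)
open Literature.MathematicalPhysics.QuantumFieldTheory.Balaban1983to89.B4TorusKernel.MultiPeriod (torusSupNorm
  torusSupNorm_nonneg)
open Literature.MathematicalPhysics.QuantumFieldTheory.Balaban1983to89.B6MultiLevelBoxOperator
open Literature.MathematicalPhysics.QuantumFieldTheory.Balaban1983to89.B6MultiLevelTorusOperator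
open Literature.MathematicalPhysics.QuantumFieldTheory.Balaban1983to89.B6Geom246MultiLevelBox
open Literature.MathematicalPhysics.QuantumFieldTheory.Balaban1983to89.B6Geom246MultiLevelTorus
open Literature.MathematicalPhysics.QuantumFieldTheory.Balaban1983to89.B6Prop22MultiLevelTorus (prop22_first_multiLevelTorus)
open Literature.MathematicalPhysics.QuantumFieldTheory.Balaban1983to89.B6Prop22DerivMultiLevelTorus (dT dT_mulVec
  prop22_second_multiLevelTorus)
open Literature.MathematicalPhysics.QuantumFieldTheory.Balaban1983to89.B6Prop22AdjMultiLevelTorus (prop22_third_multiLevelTorus)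
open Literature.MathematicalPhysics.QuantumFieldTheory.Balaban1983to89.B6Prop22HolderMultiLevelTorus
  (abs_sub_lt_of_blkOf_eq torusSupNorm_sub_of_blkOf)
open Literature.MathematicalPhysics.QuantumFieldTheory.Balaban1983to89.B6Prop22DualHolderMultiLevelTorus
  (prop22_fifth_multiLevelTorus)
open Literature.MathematicalPhysics.QuantumFieldTheory.Balaban1983to89.B6RandomWalk (HasMajorant BlockSupp)
open Literature.MathematicalPhysics.QuantumFieldTheory.Balaban1983to89.B6Ineq243TwoLevelBox (aNext)
open Literature.MathematicalPhysics.QuantumFieldTheory.Balaban1983to89.B6Lemma21Repaired (Ineq261With)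
open Literature.MathematicalPhysics.QuantumFieldTheory.Balaban1983to89.B9Thm314GpFlatTorusGeometry
open Literature.MathematicalPhysics.QuantumFieldTheory.Balaban1983to89.B9Thm314GpFlatResolvent
open Literature.MathematicalPhysics.QuantumFieldTheory.Balaban1983to89.B9Thm314GpFlatMultiLevelTorus
open Literature.MathematicalPhysics.QuantumFieldTheory.Balaban1983to89.B9Thm314GpFlatHolder

noncomputable section

variable {d : ℕ}

/-! ## §1 Telescoping inside a top block and the block bound of the difference functional -/

section Tele

/-- **TELESCOPING ALONG A MONOTONE LATTICE PATH** (the discrete mean-value device «a difference over distance `s` is a sum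
of `≤ (d+1)s` nearest-neighbour differences»): a symmetric, subadditive functional `Φ` of pairs of box points vanishing on
the diagonal that is `≤ B` on nearest-neighbour pairs of the order interval `[lo, hi]` is `≤ m·B` on every pair of the
interval at `ℓ¹`-distance `≤ m` (mirrors the private device of `B6Prop22HolderTwoLevelBox`). [folklore] [cite: Balaban1983RegularityDecay, Theorem (1.9) p.573 (the Hölder quotient), dictionary] -/
theorem tele_le {N' : Fin (d + 1) → ℕ} (Φ : ↥(boxDom N') → ↥(boxDom N') → ℝ)
    (hsymm : ∀ a b, Φ a b = Φ b a) (htri : ∀ a b c, Φ a c ≤ Φ a b + Φ b c) (hzero : ∀ a, Φ a a = 0)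
    (lo hi : Fin (d + 1) → ℤ) {B : ℝ} (hB0 : 0 ≤ B)
    (hB : ∀ (i : Fin (d + 1)) (u ue : ↥(boxDom N')), ue.1 = u.1 + Pi.single i 1 →
      (∀ j, lo j ≤ u.1 j) → (∀ j, ue.1 j ≤ hi j) → Φ u ue ≤ B) :
    ∀ (m : ℕ) (a b : ↥(boxDom N')), (∀ j, lo j ≤ a.1 j ∧ a.1 j ≤ hi j) → (∀ j, lo j ≤ b.1 j ∧ b.1 j ≤ hi j) →
      ∑ j, |b.1 j - a.1 j| ≤ (m : ℤ) → Φ a b ≤ m * B := by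
  intro m
  induction m with
  | zero =>
      intro a b ha hb hab
      have h0 : ∑ j, |b.1 j - a.1 j| = 0 :=
        le_antisymm (by exact_mod_cast hab) (Finset.sum_nonneg fun j _ => abs_nonneg _)
      have hba : b = a := by
        apply Subtype.ext
        funext j
        have := (Finset.sum_eq_zero_iff_of_nonneg fun j _ => abs_nonneg (b.1 j - a.1 j)).1 h0 j (Finset.mem_univ _)
        have := abs_eq_zero.1 this
        linarith
      rw [hba, hzero]
      simp
  | succ m ih =>
      intro a b ha hb hab
      by_cases heq : b = a
      · rw [heq, hzero]; positivity
      · have hex : ∃ i, a.1 i ≠ b.1 i := by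
          by_contra hall
          push Not at hall
          exact heq (Subtype.ext (funext fun j => (hall j).symm))
        obtain ⟨i, hine⟩ := hex
        have haB := mem_boxDom.1 a.2
        have hbB := mem_boxDom.1 b.2
        rcases lt_or_gt_of_ne hine with hlt | hgt
        · -- step up in direction `i`
          have hmem : a.1 + Pi.single i 1 ∈ boxDom N' := by
            rw [mem_boxDom]
            intro j
            by_cases hj : j = i
            · subst hj
              simp only [Pi.add_apply, Pi.single_eq_same]
              have := haB j; have := hbB j
              constructor <;> omega
            · simp only [Pi.add_apply, Pi.single_eq_of_ne hj, add_zero]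
              exact haB j
          obtain ⟨a₁, ha₁def⟩ : ∃ a₁ : ↥(boxDom N'), a₁ = ⟨a.1 + Pi.single i 1, hmem⟩ := ⟨_, rfl⟩
          have ha₁v : ∀ j, a₁.1 j = a.1 j + (Pi.single i (1 : ℤ) : Fin (d + 1) → ℤ) j := fun j => by
            rw [ha₁def]; rfl
          have ha₁ : ∀ j, lo j ≤ a₁.1 j ∧ a₁.1 j ≤ hi j := by
            intro j
            rw [ha₁v j]
            by_cases hj : j = i
            · subst hj
              rw [Pi.single_eq_same]
              have := (ha j).1; have := (hb j).2
              constructor <;> omega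
            · rw [Pi.single_eq_of_ne hj, add_zero]
              exact ha j
          have hsum : ∑ j, |b.1 j - a₁.1 j| ≤ (m : ℤ) := by
            have e : ∀ j, |b.1 j - a₁.1 j| = |b.1 j - a.1 j| - (Pi.single i (1 : ℤ) : Fin (d + 1) → ℤ) j := by
              intro j
              rw [ha₁v j]
              by_cases hj : j = i
              · subst hj
                rw [Pi.single_eq_same, abs_of_nonneg (by omega), abs_of_nonneg (by omega)]
                ring
              · rw [Pi.single_eq_of_ne hj, add_zero, sub_zero]
            rw [Finset.sum_congr rfl fun j _ => e j, Finset.sum_sub_distrib, Finset.sum_pi_single',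
              if_pos (Finset.mem_univ _)]
            push_cast at hab
            omega
          have h1 : Φ a a₁ ≤ B := hB i a a₁ (funext fun j => ha₁v j) (fun j => (ha j).1) (fun j => (ha₁ j).2)
          have h2 : Φ a₁ b ≤ m * B := ih a₁ b ha₁ hb hsum
          calc Φ a b ≤ Φ a a₁ + Φ a₁ b := htri _ _ _
            _ ≤ B + m * B := add_le_add h1 h2
            _ = ((m + 1 : ℕ) : ℝ) * B := by push_cast; ring
        · -- step down in direction `i`
          have hmem : a.1 - Pi.single i 1 ∈ boxDom N' := by
            rw [mem_boxDom]
            intro j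
            by_cases hj : j = i
            · subst hj
              simp only [Pi.sub_apply, Pi.single_eq_same]
              have := haB j; have := hbB j
              constructor <;> omega
            · simp only [Pi.sub_apply, Pi.single_eq_of_ne hj, sub_zero]
              exact haB j
          obtain ⟨a₁, ha₁def⟩ : ∃ a₁ : ↥(boxDom N'), a₁ = ⟨a.1 - Pi.single i 1, hmem⟩ := ⟨_, rfl⟩
          have ha₁v : ∀ j, a₁.1 j = a.1 j - (Pi.single i (1 : ℤ) : Fin (d + 1) → ℤ) j := fun j => by
            rw [ha₁def]; rfl
          have ha₁ : ∀ j, lo j ≤ a₁.1 j ∧ a₁.1 j ≤ hi j := by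
            intro j
            rw [ha₁v j]
            by_cases hj : j = i
            · subst hj
              rw [Pi.single_eq_same]
              have := (ha j).2; have := (hb j).1
              constructor <;> omega
            · rw [Pi.single_eq_of_ne hj, sub_zero]
              exact ha j
          have hsum : ∑ j, |b.1 j - a₁.1 j| ≤ (m : ℤ) := by
            have e : ∀ j, |b.1 j - a₁.1 j| = |b.1 j - a.1 j| - (Pi.single i (1 : ℤ) : Fin (d + 1) → ℤ) j := by
              intro j
              rw [ha₁v j]
              by_cases hj : j = i
              · subst hj
                rw [Pi.single_eq_same, abs_of_nonpos (by omega), abs_of_nonpos (by omega)]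
                ring
              · rw [Pi.single_eq_of_ne hj, sub_zero, sub_zero]
            rw [Finset.sum_congr rfl fun j _ => e j, Finset.sum_sub_distrib, Finset.sum_pi_single',
              if_pos (Finset.mem_univ _)]
            push_cast at hab
            omega
          have hae : a.1 = a₁.1 + Pi.single i 1 := by
            funext j; rw [Pi.add_apply, ha₁v j]; ring
          have h1 : Φ a a₁ ≤ B := by
            rw [hsymm]
            exact hB i a₁ a hae (fun j => (ha₁ j).1) (fun j => (ha j).2)
          have h2 : Φ a₁ b ≤ m * B := ih a₁ b ha₁ hb hsum
          calc Φ a b ≤ Φ a a₁ + Φ a₁ b := htri _ _ _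
            _ ≤ B + m * B := add_le_add h1 h2
            _ = ((m + 1 : ℕ) : ℝ) * B := by push_cast; ring

variable {ℓ Mh k R : ℕ} {P : Fin (d + 1) → ℕ}

/-- **A TOP BLOCK IS AN ORDER INTERVAL OF THE FUNDAMENTAL BOX**: for a block `(k, β)` of `𝔅[D]` (side `L^k`) the sites of
the block are exactly the sites `z` with `β_νL^k ≤ z_ν ≤ β_νL^k + L^k − 1`, and every integer vector in that interval is a
site of the box. [cite: Balaban1984PropagatorsII, (2.45) p.231 («B^j(y)»), (2.1) p.224, dictionary] -/
theorem blockBox (D : TDomains d ℓ Mh k P R) {p : ℕ × (Fin (d + 1) → ℤ)} (hpD : p ∈ bset D.toDomains) (hp : p.1 = k)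
    {x : ↥(boxDom (N0 ℓ Mh k P))} (hx : blkOf D.toDomains x = ⟨p, hpD⟩) :
    (∀ z : ↥(boxDom (N0 ℓ Mh k P)), blkOf D.toDomains z = ⟨p, hpD⟩ →
        ∀ j, p.2 j * ((ℓ + 1) ^ k : ℕ) ≤ z.1 j ∧ z.1 j ≤ p.2 j * ((ℓ + 1) ^ k : ℕ) + (((ℓ + 1) ^ k : ℕ) - 1)) ∧
      (∀ z : Fin (d + 1) → ℤ,
        (∀ j, p.2 j * ((ℓ + 1) ^ k : ℕ) ≤ z j ∧ z j ≤ p.2 j * ((ℓ + 1) ^ k : ℕ) + (((ℓ + 1) ^ k : ℕ) - 1)) →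
        z ∈ boxDom (N0 ℓ Mh k P)) ∧
      (∀ z : ↥(boxDom (N0 ℓ Mh k P)),
        (∀ j, p.2 j * ((ℓ + 1) ^ k : ℕ) ≤ z.1 j ∧ z.1 j ≤ p.2 j * ((ℓ + 1) ^ k : ℕ) + (((ℓ + 1) ^ k : ℕ) - 1)) →
        blkOf D.toDomains z = ⟨p, hpD⟩) := by
  have hs : (0 : ℤ) < ((ℓ + 1) ^ k : ℕ) := by exact_mod_cast Nat.one_le_pow _ _ (by omega)
  -- the block label is the integer quotient by the side
  have hlab : ∀ z : ↥(boxDom (N0 ℓ Mh k P)), blkOf D.toDomains z = ⟨p, hpD⟩ ↔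
      ∀ j, z.1 j / (((ℓ + 1) ^ k : ℕ) : ℤ) = p.2 j := by
    intro z
    rw [blkOf_eq_iff_blk]
    show blk ((ℓ + 1) ^ p.1) z.1 = p.2 ↔ _
    rw [hp]
    constructor
    · intro h j; have := congrFun h j; simpa only [blk] using this
    · intro h; funext j; simp only [blk]; exact h j
  refine ⟨fun z hz j => ?_, fun z hz => ?_, fun z hz => ?_⟩
  · have hq := (hlab z).1 hz j
    have h1 := Int.emod_add_ediv_mul (z.1 j) (((ℓ + 1) ^ k : ℕ) : ℤ)
    have h2 := Int.emod_nonneg (z.1 j) hs.ne'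
    have h3 := Int.emod_lt_of_pos (z.1 j) hs
    rw [hq] at h1
    constructor <;> linarith
  · rw [mem_boxDom]
    intro j
    have hxq := (hlab x).1 hx j
    have hxB := (mem_boxDom.1 x.2) j
    -- `0 ≤ β_j` and `(β_j + 1)·L^k ≤ N_j`
    have hβ0 : 0 ≤ p.2 j := by rw [← hxq]; exact Int.ediv_nonneg hxB.1 hs.le
    obtain ⟨c, hc⟩ := TDomains.pow_dvd_bigSide (ℓ := ℓ) (Mh := Mh) (k := k) (j := k) (Nat.le_succ k)
    have hN : (N0 ℓ Mh k P j : ℤ) = (((ℓ + 1) ^ k : ℕ) : ℤ) * ((c * P j : ℕ) : ℤ) := by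
      rw [N0_eq_bigSide_mul, hc]; push_cast; ring
    have hβlt : p.2 j < ((c * P j : ℕ) : ℤ) := by
      rw [← hxq]
      refine Int.ediv_lt_of_lt_mul hs ?_
      rw [mul_comm, ← hN]; exact hxB.2
    constructor
    · nlinarith [(hz j).1]
    · have : (p.2 j + 1) * (((ℓ + 1) ^ k : ℕ) : ℤ) ≤ (N0 ℓ Mh k P j : ℤ) := by
        rw [hN, mul_comm (((((ℓ + 1) ^ k : ℕ)) : ℤ))]
        exact mul_le_mul_of_nonneg_right (by omega) hs.le
      linarith [(hz j).2]
  · refine (hlab z).2 fun j => ?_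
    have h1 : p.2 j ≤ z.1 j / (((ℓ + 1) ^ k : ℕ) : ℤ) := Int.le_ediv_of_mul_le hs (by linarith [(hz j).1])
    have h2 : z.1 j / (((ℓ + 1) ^ k : ℕ) : ℤ) < p.2 j + 1 := Int.ediv_lt_of_lt_mul hs (by linarith [(hz j).2])
    omega

/-- the DIFFERENCE FUNCTIONAL at two sites with a scalar prefactor `c` (`= |x′−x|_T^{−α}`): `u ↦ c·((Gu)(x′) − (Gu)(x))`.
[cite: Balaban1984PropagatorsII, (2.67) p.234 (fifth entry), dictionary] -/
def diffFun (N : Fin (d + 1) → ℕ) (G : Matrix ↥(boxDom N) ↥(boxDom N) ℝ) (x x' : ↥(boxDom N)) (c : ℝ) :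
    (↥(boxDom N) → ℝ) →ₗ[ℝ] ℝ where
  toFun u := c * ((G *ᵥ u) x' - (G *ᵥ u) x)
  map_add' u v := by
    simp only [Matrix.mulVec_add, Pi.add_apply]
    ring
  map_smul' r u := by
    simp only [Matrix.mulVec_smul, Pi.smul_apply, smul_eq_mul, RingHom.id_apply]
    ring

/-- unfolding `diffFun`. [cite: Balaban1984PropagatorsII, (2.67) p.234 (fifth entry), dictionary] -/
theorem diffFun_apply (N : Fin (d + 1) → ℕ) (G : Matrix ↥(boxDom N) ↥(boxDom N) ℝ) (x x' : ↥(boxDom N)) (c : ℝ)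
    (u : ↥(boxDom N) → ℝ) : diffFun N G x x' c u = c * ((G *ᵥ u) x' - (G *ᵥ u) x) := rfl

/-- **THE BLOCK BOUND OF THE DIFFERENCE FUNCTIONAL ON A TOP BLOCK** from the `∇G′` majorants of all directions:
for `x ≠ x′` in the top block `y = (k, β)` and `supp u ⊂ B(b)`, `|u| ≤ B`:
`|x′−x|_T^{−α}·|(Gu)(x′) − (Gu)(x)| ≤ (d+1)·C₂·(L^k)^{1−α}·L^k·e^{−δd(y,b)}·B`.
[cite: Balaban1984PropagatorsII, (2.67) p.234 (second and fifth entries); Balaban1983RegularityDecay, Theorem (1.9) p.573] -/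
theorem abs_diffFun_le (D : TDomains d ℓ Mh k P R) (hMh : 1 ≤ Mh) (hP4 : ∀ μ, 4 ≤ P μ)
    {G : Matrix ↥(boxDom (N0 ℓ Mh k P)) ↥(boxDom (N0 ℓ Mh k P)) ℝ} {C₂ δ : ℝ} (hC₂ : 0 ≤ C₂)
    (hS : ∀ i : Fin (d + 1), HasMajorant (g := geomT D) (blkOf D.toDomains)
      (Matrix.toLin' (dT (N0 ℓ Mh k P) i * G))
      (fun y y' => C₂ * ((ℓ : ℝ) + 1) ^ y.1.1 * Real.exp (-(δ * (geomT D).dist y y'))))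
    {α : ℝ} (hα1 : α < 1)
    {p : ℕ × (Fin (d + 1) → ℤ)} (hpD : p ∈ bset D.toDomains) (hp : p.1 = k)
    {x x' : ↥(boxDom (N0 ℓ Mh k P))} (hne : x'.1 ≠ x.1) (hx : blkOf D.toDomains x = ⟨p, hpD⟩)
    (hx' : blkOf D.toDomains x' = ⟨p, hpD⟩)
    (b : ↥(bset D.toDomains)) (u : ↥(boxDom (N0 ℓ Mh k P)) → ℝ) (Bu : ℝ)
    (hu : BlockSupp (g := geomT D) (blkOf D.toDomains) u b Bu) :
    |diffFun (N0 ℓ Mh k P) G x x' ((torusSupNorm (N0 ℓ Mh k P) (x'.1 - x.1)) ^ (-α)) u|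
      ≤ ((d : ℝ) + 1) * C₂ * (((ℓ : ℝ) + 1) ^ k) ^ (1 - α) * ((ℓ : ℝ) + 1) ^ k
        * Real.exp (-(δ * (geomT D).dist ⟨p, hpD⟩ b)) * Bu := by
  have hP : ∀ μ, 1 ≤ P μ := fun μ => le_trans (by norm_num) (hP4 μ)
  have hL0 : (0 : ℝ) < (ℓ : ℝ) + 1 := by positivity
  have hBu : 0 ≤ Bu := hu.nonneg
  obtain ⟨hin, hbox, hblk⟩ := blockBox D hpD hp hx
  -- the nearest-neighbour bound inside the block
  obtain ⟨W, hW⟩ : ∃ W : ℝ, W = C₂ * ((ℓ : ℝ) + 1) ^ k * Real.exp (-(δ * (geomT D).dist ⟨p, hpD⟩ b)) * Bu := ⟨_, rfl⟩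
  have hW0 : 0 ≤ W := by rw [hW]; positivity
  have hnn : ∀ (i : Fin (d + 1)) (v ve : ↥(boxDom (N0 ℓ Mh k P))), ve.1 = v.1 + Pi.single i 1 →
      (∀ j, p.2 j * ((ℓ + 1) ^ k : ℕ) ≤ v.1 j) →
      (∀ j, ve.1 j ≤ p.2 j * ((ℓ + 1) ^ k : ℕ) + (((ℓ + 1) ^ k : ℕ) - 1)) →
      |(G *ᵥ u) ve - (G *ᵥ u) v| ≤ W := by
    intro i v ve hve hlo hhi
    -- `v` lies in the block
    have hvin : ∀ j, p.2 j * ((ℓ + 1) ^ k : ℕ) ≤ v.1 j ∧ v.1 j ≤ p.2 j * ((ℓ + 1) ^ k : ℕ) + (((ℓ + 1) ^ k : ℕ) - 1) := by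
      intro j
      refine ⟨hlo j, ?_⟩
      have h := hhi j
      rw [hve, Pi.add_apply] at h
      by_cases hj : j = i
      · subst hj; rw [Pi.single_eq_same] at h; linarith
      · rw [Pi.single_eq_of_ne hj] at h; linarith
    have hvblk : blkOf D.toDomains v = ⟨p, hpD⟩ := hblk v hvin
    -- `ve = σ_{e_i} v`
    have hve' : tshift (N0 ℓ Mh k P) (unitVec i) v = ve := by
      apply Subtype.ext
      rw [tshift_val_of_mem (by rw [unitVec, ← hve]; exact ve.2), unitVec, hve]
    have h := hS i b u Bu hu v
    rw [Matrix.toLin'_apply, ← Matrix.mulVec_mulVec, dT_mulVec, hve', hvblk] at h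
    calc |(G *ᵥ u) ve - (G *ᵥ u) v| ≤ C₂ * ((ℓ : ℝ) + 1) ^ p.1 * Real.exp (-(δ * (geomT D).dist ⟨p, hpD⟩ b)) * Bu := h
      _ = W := by rw [hW, hp]
  -- telescoping
  have hsum0 : 0 ≤ ∑ j, |x'.1 j - x.1 j| := Finset.sum_nonneg fun j _ => abs_nonneg _
  have htele := tele_le (fun v w : ↥(boxDom (N0 ℓ Mh k P)) => |(G *ᵥ u) w - (G *ᵥ u) v|)
    (fun v w => abs_sub_comm _ _) (fun v w z => by
      have : (G *ᵥ u) z - (G *ᵥ u) v = ((G *ᵥ u) w - (G *ᵥ u) v) + ((G *ᵥ u) z - (G *ᵥ u) w) := by ring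
      rw [this]; exact abs_add_le _ _) (fun v => by simp)
    (fun j => p.2 j * ((ℓ + 1) ^ k : ℕ)) (fun j => p.2 j * ((ℓ + 1) ^ k : ℕ) + (((ℓ + 1) ^ k : ℕ) - 1)) hW0 hnn
    (∑ j, |x'.1 j - x.1 j|).toNat x x' (hin x hx) (hin x' hx') (by rw [Int.toNat_of_nonneg hsum0])
  -- the `ℓ¹` length against the torus distance
  have hTS : torusSupNorm (N0 ℓ Mh k P) (x'.1 - x.1) = supNorm (x'.1 - x.1) :=
    torusSupNorm_sub_of_blkOf hMh hP4 (by rw [hx, hx'])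
  have hlen : (((∑ j, |x'.1 j - x.1 j|).toNat : ℕ) : ℝ) ≤ ((d : ℝ) + 1) * supNorm (x'.1 - x.1) := by
    have e : (((∑ j, |x'.1 j - x.1 j|).toNat : ℕ) : ℝ) = ∑ j, (((|x'.1 j - x.1 j| : ℤ)) : ℝ) := by
      have : (((∑ j, |x'.1 j - x.1 j|).toNat : ℕ) : ℤ) = ∑ j, |x'.1 j - x.1 j| := Int.toNat_of_nonneg hsum0
      exact_mod_cast this
    rw [e]
    calc ∑ j, (((|x'.1 j - x.1 j| : ℤ)) : ℝ) ≤ ∑ _j : Fin (d + 1), supNorm (x'.1 - x.1) :=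
          Finset.sum_le_sum fun j _ => by
            have := abs_le_supNorm (x'.1 - x.1) j
            rwa [Pi.sub_apply] at this
      _ = ((d : ℝ) + 1) * supNorm (x'.1 - x.1) := by
          rw [Finset.sum_const, Finset.card_univ, Fintype.card_fin, nsmul_eq_mul]; push_cast; ring
  -- `1 ≤ |x′−x| < L^k`
  have hSlt : supNorm (x'.1 - x.1) < ((ℓ : ℝ) + 1) ^ k := by
    obtain ⟨i, hi⟩ := exists_supNorm_eq (x'.1 - x.1)
    rw [hi, Pi.sub_apply]
    have h := abs_sub_lt_of_blkOf_eq (D' := D.toDomains) (x := x) (x' := x') (by rw [hx, hx']) i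
    have hlev : D.toDomains.lev x.1 = k := by
      have : (blkOf D.toDomains x).1.1 = p.1 := by rw [hx]
      exact this.trans hp
    rw [hlev] at h
    have h' : (((|x'.1 i - x.1 i| : ℤ)) : ℝ) < ((((ℓ + 1) ^ k : ℕ) : ℤ) : ℝ) := by exact_mod_cast h
    simpa using h'
  have hS1 : 1 ≤ supNorm (x'.1 - x.1) := by
    have hex : ∃ i, x'.1 i ≠ x.1 i := by
      by_contra hall
      push Not at hall
      exact hne (funext hall)
    obtain ⟨i, hi⟩ := hex
    have h1 : (1 : ℤ) ≤ |x'.1 i - x.1 i| := Int.one_le_abs (sub_ne_zero.2 hi)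
    have h2 := abs_le_supNorm (x'.1 - x.1) i
    rw [Pi.sub_apply] at h2
    exact le_trans (by exact_mod_cast h1) h2
  have hS0 : 0 < supNorm (x'.1 - x.1) := lt_of_lt_of_le one_pos hS1
  -- assemble
  rw [diffFun_apply, abs_mul, abs_of_nonneg (Real.rpow_nonneg (torusSupNorm_nonneg (one_le_N0 hMh hP) _) _), hTS]
  have hpow : supNorm (x'.1 - x.1) ^ (-α) * supNorm (x'.1 - x.1) = supNorm (x'.1 - x.1) ^ (1 - α) := by
    conv_lhs => rw [← Real.rpow_one (supNorm (x'.1 - x.1))]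
    rw [← Real.rpow_mul hS0.le, ← Real.rpow_add hS0]; norm_num; ring_nf
  have hmono : supNorm (x'.1 - x.1) ^ (1 - α) ≤ (((ℓ : ℝ) + 1) ^ k) ^ (1 - α) :=
    Real.rpow_le_rpow hS0.le hSlt.le (by linarith)
  calc supNorm (x'.1 - x.1) ^ (-α) * |(G *ᵥ u) x' - (G *ᵥ u) x|
      ≤ supNorm (x'.1 - x.1) ^ (-α) * ((((∑ j, |x'.1 j - x.1 j|).toNat : ℕ) : ℝ) * W) :=
        mul_le_mul_of_nonneg_left htele (Real.rpow_nonneg hS0.le _)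
    _ ≤ supNorm (x'.1 - x.1) ^ (-α) * ((((d : ℝ) + 1) * supNorm (x'.1 - x.1)) * W) :=
        mul_le_mul_of_nonneg_left (mul_le_mul_of_nonneg_right hlen hW0) (Real.rpow_nonneg hS0.le _)
    _ = ((d : ℝ) + 1) * (supNorm (x'.1 - x.1) ^ (-α) * supNorm (x'.1 - x.1)) * W := by ring
    _ = ((d : ℝ) + 1) * supNorm (x'.1 - x.1) ^ (1 - α) * W := by rw [hpow]
    _ ≤ ((d : ℝ) + 1) * (((ℓ : ℝ) + 1) ^ k) ^ (1 - α) * W :=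
        mul_le_mul_of_nonneg_right (mul_le_mul_of_nonneg_left hmono (by positivity)) hW0
    _ = _ := by rw [hW]; ring

end Tele

/-! ## §2 The dual Hölder entry [4] (2.67)₅ for the difference `G′[D] − G′[D′]` -/

section DualHolder

variable {ℓ Mh k R : ℕ} {P : Fin (d + 1) → ℕ}

set_option maxHeartbeats 800000 in
/-- **THEOREM 3.14 AT `U = 1`, THE DUAL HÖLDER ENTRY [4] (2.67)₅ = [B9] (3.43)₂ (`G′∇*`, Hölder quotient)**: for
`0 ≤ α < 1`, two torus families, a common top block `y ∋ x ≠ x′` and `y′ ⊃ supp λ`: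
`|x′−x|_T^{−α}·|((G′[D] − G′[D′])∇_μ*λ)(x′) − ((G′[D] − G′[D′])∇_μ*λ)(x)| ≤ C·(L^k)^{1−α}·e^{−δ·min(d_D,d_{D′})(y,y′)}·e^{−δ·d(y,y′,Ω)}·B`,
constants `k`-uniform, uniform in `μ`, depending on `α`. [cite: Balaban1985BackgroundPropagators, Thm 3.14 (3.154) pp.426–427, (3.43) p.398; Balaban1984PropagatorsII, Prop. 2.2 (2.67) p.234 (fifth entry)] -/
theorem thm314_Gpd_holder_flat_multiLevelTorus (d ℓ : ℕ) (hℓ : 1 ≤ ℓ) (aminus aplus a2minus a2plus : ℝ)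
    (ha : 0 < aminus) (ha2 : 0 < a2minus) (α : ℝ) (hα0 : 0 ≤ α) (hα1 : α < 1) :
    ∃ δ C M₀ : ℝ, ∃ N₀ : ℕ, 0 < δ ∧ 0 < C ∧ 0 < M₀ ∧ 0 < N₀ ∧
      ∀ (k Mh R : ℕ), 3 ≤ Mh → M₀ ≤ ((ℓ : ℝ) + 1) * Mh → 2 * (ℓ + 1) ≤ R → N₀ + 1 ≤ R * ((ℓ + 1) * Mh) →
      ∀ (P : Fin (d + 1) → ℕ) (hP : ∀ μ, 1 ≤ P μ) (hP4 : ∀ μ, 4 ≤ P μ) (D D' : TDomains d ℓ Mh k P R)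
        (a c : ℕ → ℝ), (∀ i, 1 ≤ i → aminus ≤ a i ∧ a i ≤ aplus) → (∀ i, 1 ≤ i → a2minus ≤ c i ∧ c i ≤ a2plus) →
        (∀ i, 1 ≤ i → a (i + 1) = aNext ℓ (a i) (c i)) →
      ∀ (p q : ℕ × (Fin (d + 1) → ℤ)) (hpD : p ∈ bset D.toDomains) (hpD' : p ∈ bset D'.toDomains)
        (hqD : q ∈ bset D.toDomains) (hqD' : q ∈ bset D'.toDomains), p.1 = k → q.1 = k →
      ∀ (lam : ↥(boxDom (N0 ℓ Mh k P)) → ℝ) (B : ℝ),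
        BlockSupp (g := geomT D) (blkOf D.toDomains) lam ⟨q, hqD⟩ B →
      ∀ (μ : Fin (d + 1)) (x x' : ↥(boxDom (N0 ℓ Mh k P))), x'.1 ≠ x.1 →
        blkOf D.toDomains x = ⟨p, hpD⟩ → blkOf D.toDomains x' = ⟨p, hpD⟩ →
        (torusSupNorm (N0 ℓ Mh k P) (x'.1 - x.1)) ^ (-α)
            * |((gmlT (N0 ℓ Mh k P) ℓ k D.lev a * (dT (N0 ℓ Mh k P) μ)ᵀ
                  - gmlT (N0 ℓ Mh k P) ℓ k D'.lev a * (dT (N0 ℓ Mh k P) μ)ᵀ) *ᵥ lam) x'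
              - ((gmlT (N0 ℓ Mh k P) ℓ k D.lev a * (dT (N0 ℓ Mh k P) μ)ᵀ
                  - gmlT (N0 ℓ Mh k P) ℓ k D'.lev a * (dT (N0 ℓ Mh k P) μ)ᵀ) *ᵥ lam) x|
          ≤ C * (((ℓ : ℝ) + 1) ^ k) ^ (1 - α)
              * Real.exp (-(δ * min ((geomT D).dist ⟨p, hpD⟩ ⟨q, hqD⟩) ((geomT D').dist ⟨p, hpD'⟩ ⟨q, hqD'⟩)))
              * Real.exp (-(δ * dOmega D D' p.2 q.2)) * B := by
  obtain ⟨δ₂, C₂, M₂, N₂, hδ₂, hC₂, hM₂, -, hsecond⟩ :=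
    prop22_second_multiLevelTorus d ℓ hℓ aminus aplus a2minus a2plus ha ha2
  obtain ⟨δ₃, C₃, M₃, N₃, hδ₃, hC₃, hM₃, -, hthird⟩ := prop22_third_multiLevelTorus d ℓ hℓ aminus aplus a2minus a2plus ha ha2
  obtain ⟨δ₅, C₅, M₅, N₅, hδ₅, hC₅, hM₅, -, hfifth⟩ :=
    prop22_fifth_multiLevelTorus d ℓ hℓ aminus aplus a2minus a2plus ha ha2 α hα0 hα1
  have hL0 : (0 : ℝ) < (ℓ : ℝ) + 1 := by positivity
  -- the common rate
  obtain ⟨δ, hδ⟩ : ∃ δ : ℝ, δ = min (δ₂ / 2) (min (δ₃ / 2) (δ₅ / 2)) := ⟨_, rfl⟩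
  have hδpos : 0 < δ := by rw [hδ]; exact lt_min (by positivity) (lt_min (by positivity) (by positivity))
  have hδ2' : δ ≤ δ₂ / 2 := by rw [hδ]; exact min_le_left _ _
  have hδ3' : δ ≤ δ₃ / 2 := by rw [hδ]; exact (min_le_right _ _).trans (min_le_left _ _)
  have hδ5' : δ ≤ δ₅ / 2 := by rw [hδ]; exact (min_le_right _ _).trans (min_le_right _ _)
  -- the `k`-uniform (2.60)/(2.61) thresholds and constants at the rate `δ`
  obtain ⟨N₁, cK, hN₁, hcK0, hcon⟩ := consts_260_261 d ℓ hδpos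
  have hap0 : 0 ≤ max aplus aminus := le_trans ha.le (le_max_right _ _)
  obtain ⟨KR, hKR⟩ : ∃ KR : ℝ, KR = 2 * C₃ * max aplus aminus * ((ℓ : ℝ) + 1) ^ 2 * Real.exp (3 / 2 * δ) * cK :=
    ⟨_, rfl⟩
  have hKR0 : 0 ≤ KR := by rw [hKR]; positivity
  obtain ⟨KL, hKL⟩ : ∃ KL : ℝ, KL = ((d : ℝ) + 1) * C₂ := ⟨_, rfl⟩
  have hKL0 : 0 ≤ KL := by rw [hKL]; positivity
  refine ⟨1 / 4 * δ, Real.sqrt (2 * C₅) * Real.sqrt (KL * KR) + 1, max M₂ (max M₃ M₅), max (max N₂ (max N₃ N₅)) N₁,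
    by positivity, by positivity, lt_of_lt_of_le hM₂ (le_max_left _ _), lt_of_lt_of_le hN₁ (le_max_right _ _), ?_⟩
  intro k Mh R hMh hM hR hRM P hP hP4 D D' a c haw hcw hac p q hpD hpD' hqD hqD' hp hq lam B hlam μ x x' hne hx hx'
  have hMh1 : 1 ≤ Mh := le_trans (by norm_num) hMh
  have hM2' : M₂ ≤ ((ℓ : ℝ) + 1) * Mh := le_trans (le_max_left _ _) hM
  have hM3' : M₃ ≤ ((ℓ : ℝ) + 1) * Mh := le_trans ((le_max_left _ _).trans (le_max_right _ _)) hM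
  have hM5' : M₅ ≤ ((ℓ : ℝ) + 1) * Mh := le_trans ((le_max_right _ _).trans (le_max_right _ _)) hM
  have hRN2 : N₂ + 1 ≤ R * ((ℓ + 1) * Mh) :=
    le_trans (Nat.add_le_add_right ((le_max_left N₂ _).trans (le_max_left _ N₁)) 1) hRM
  have hRN3 : N₃ + 1 ≤ R * ((ℓ + 1) * Mh) :=
    le_trans (Nat.add_le_add_right (((le_max_left N₃ N₅).trans (le_max_right N₂ _)).trans (le_max_left _ N₁)) 1) hRM
  have hRN5 : N₅ + 1 ≤ R * ((ℓ + 1) * Mh) :=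
    le_trans (Nat.add_le_add_right (((le_max_right N₃ N₅).trans (le_max_right N₂ _)).trans (le_max_left _ N₁)) 1) hRM
  have hRN1 : N₁ + 1 ≤ R * ((ℓ + 1) * Mh) := le_trans (Nat.add_le_add_right (le_max_right _ _) 1) hRM
  have hRMone : 1 ≤ R * ((ℓ + 1) * Mh) := le_trans (by omega) hRN1
  obtain ⟨hthr, h261f⟩ := hcon k Mh R P hMh1 hP hRN1
  -- the weights with level `0` repaired; abbreviations
  obtain ⟨a', ha'0, ha'p, ha'1, ha'eq⟩ := weights_repair ha haw
  have hS := hsecond k Mh R hMh hM2' hR hRN2 P hP hP4 D a c haw hcw hac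
  have hTm := hthird k Mh R hMh hM3' hR hRN3 P hP hP4 D' a c haw hcw hac μ
  have hH := hfifth k Mh R hMh hM5' hR hRN5 P hP hP4 D a c haw hcw hac μ
  have hH' := hfifth k Mh R hMh hM5' hR hRN5 P hP hP4 D' a c haw hcw hac μ
  rw [gmlT_congr D' ha'eq] at hTm hH'
  rw [gmlT_congr D ha'eq] at hS hH
  rw [gmlT_congr D ha'eq, gmlT_congr D' ha'eq]
  obtain ⟨G, hG⟩ : ∃ G, G = gmlT (N0 ℓ Mh k P) ℓ k D.lev a' := ⟨_, rfl⟩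
  obtain ⟨G', hG'⟩ : ∃ G', G' = gmlT (N0 ℓ Mh k P) ℓ k D'.lev a' := ⟨_, rfl⟩
  obtain ⟨E, hE⟩ : ∃ E, E = (dT (N0 ℓ Mh k P) μ)ᵀ := ⟨_, rfl⟩
  rw [← hG] at hS hH ⊢
  rw [← hG'] at hTm hH' ⊢
  rw [← hE] at hTm hH hH' ⊢
  -- geometry of the common blocks
  have hB : 0 ≤ B := hlam.nonneg
  have hxD' : blkOf D'.toDomains x = ⟨p, hpD'⟩ := (blkOf_eq_iff_blkOf_eq D D' hpD hpD' x).1 hx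
  have hx'D' : blkOf D'.toDomains x' = ⟨p, hpD'⟩ := (blkOf_eq_iff_blkOf_eq D D' hpD hpD' x').1 hx'
  have hlevx : D.lev x.1 = k := by
    have h : (blkOf D.toDomains x).1.1 = p.1 := by rw [hx]
    exact h.trans hp
  have hlevx' : D'.lev x.1 = k := by
    have h : (blkOf D'.toDomains x).1.1 = p.1 := by rw [hxD']
    exact h.trans hp
  have hN1 : ∀ i, 1 ≤ N0 ℓ Mh k P i := one_le_N0 hMh1 hP
  have hc0 : 0 ≤ (torusSupNorm (N0 ℓ Mh k P) (x'.1 - x.1)) ^ (-α) :=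
    Real.rpow_nonneg (torusSupNorm_nonneg hN1 _) _
  have hm0 : 0 ≤ min ((geomT D).dist ⟨p, hpD⟩ ⟨q, hqD⟩) ((geomT D').dist ⟨p, hpD'⟩ ⟨q, hqD'⟩) :=
    le_min ((triangle_refl_nonneg_T D hMh1 hP).2.2 _ _) ((triangle_refl_nonneg_T D' hMh1 hP).2.2 _ _)
  have hdq : 0 ≤ (geomT D).dist ⟨p, hpD⟩ ⟨q, hqD⟩ := (triangle_refl_nonneg_T D hMh1 hP).2.2 _ _
  have hdq' : 0 ≤ (geomT D').dist ⟨p, hpD'⟩ ⟨q, hqD'⟩ := (triangle_refl_nonneg_T D' hMh1 hP).2.2 _ _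
  have hLk0 : 0 ≤ (((ℓ : ℝ) + 1) ^ k) ^ (1 - α) := Real.rpow_nonneg (by positivity) _
  -- the resolvent form of the difference
  have hsub : G * E - G' * E = G * diffM D D' a' * (G' * E) := by
    rw [← Matrix.sub_mul, hG, hG', gmlT_sub_gmlT D D' a' hMh1 hP ha'1]
    simp only [Matrix.mul_assoc]
  -- THE TRIVIAL BOUND
  have ht1 := hH ⟨q, hqD⟩ lam B hlam x x' hne (by rw [hx, hx'])
  rw [hx, hlevx] at ht1
  have ht2 := hH' ⟨q, hqD'⟩ lam B (blockSupp_transfer D D' hqD hqD' hlam) x x' hne (by rw [hxD', hx'D'])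
  rw [hxD', hlevx'] at ht2
  have hw₁ : Real.exp (-(δ₅ / 2 * (geomT D).dist ⟨p, hpD⟩ ⟨q, hqD⟩))
      ≤ Real.exp (-(δ * min ((geomT D).dist ⟨p, hpD⟩ ⟨q, hqD⟩) ((geomT D').dist ⟨p, hpD'⟩ ⟨q, hqD'⟩))) :=
    Real.exp_le_exp.2 (by nlinarith [min_le_left ((geomT D).dist ⟨p, hpD⟩ ⟨q, hqD⟩) ((geomT D').dist ⟨p, hpD'⟩ ⟨q, hqD'⟩)])
  have hw₂ : Real.exp (-(δ₅ / 2 * (geomT D').dist ⟨p, hpD'⟩ ⟨q, hqD'⟩))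
      ≤ Real.exp (-(δ * min ((geomT D).dist ⟨p, hpD⟩ ⟨q, hqD⟩) ((geomT D').dist ⟨p, hpD'⟩ ⟨q, hqD'⟩))) :=
    Real.exp_le_exp.2 (by nlinarith [min_le_right ((geomT D).dist ⟨p, hpD⟩ ⟨q, hqD⟩) ((geomT D').dist ⟨p, hpD'⟩ ⟨q, hqD'⟩)])
  have htriv : (torusSupNorm (N0 ℓ Mh k P) (x'.1 - x.1)) ^ (-α)
        * |((G * E - G' * E) *ᵥ lam) x' - ((G * E - G' * E) *ᵥ lam) x|
      ≤ 2 * C₅ * ((((ℓ : ℝ) + 1) ^ k) ^ (1 - α) * B)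
        * Real.exp (-(δ * min ((geomT D).dist ⟨p, hpD⟩ ⟨q, hqD⟩) ((geomT D').dist ⟨p, hpD'⟩ ⟨q, hqD'⟩))) := by
    have hsplit : ((G * E - G' * E) *ᵥ lam) x' - ((G * E - G' * E) *ᵥ lam) x
        = (((G * E) *ᵥ lam) x' - ((G * E) *ᵥ lam) x) - (((G' * E) *ᵥ lam) x' - ((G' * E) *ᵥ lam) x) := by
      simp only [Matrix.sub_mulVec, Pi.sub_apply]; ring
    rw [hsplit]
    calc (torusSupNorm (N0 ℓ Mh k P) (x'.1 - x.1)) ^ (-α) * |_ - _|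
        ≤ (torusSupNorm (N0 ℓ Mh k P) (x'.1 - x.1)) ^ (-α)
            * (|((G * E) *ᵥ lam) x' - ((G * E) *ᵥ lam) x| + |((G' * E) *ᵥ lam) x' - ((G' * E) *ᵥ lam) x|) :=
          mul_le_mul_of_nonneg_left (abs_sub _ _) hc0
      _ ≤ C₅ * (((ℓ : ℝ) + 1) ^ k) ^ (1 - α) * Real.exp (-(δ₅ / 2 * (geomT D).dist ⟨p, hpD⟩ ⟨q, hqD⟩)) * B
          + C₅ * (((ℓ : ℝ) + 1) ^ k) ^ (1 - α) * Real.exp (-(δ₅ / 2 * (geomT D').dist ⟨p, hpD'⟩ ⟨q, hqD'⟩)) * B := by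
          rw [mul_add]; exact add_le_add ht1 ht2
      _ ≤ C₅ * (((ℓ : ℝ) + 1) ^ k) ^ (1 - α)
            * Real.exp (-(δ * min ((geomT D).dist ⟨p, hpD⟩ ⟨q, hqD⟩) ((geomT D').dist ⟨p, hpD'⟩ ⟨q, hqD'⟩))) * B
          + C₅ * (((ℓ : ℝ) + 1) ^ k) ^ (1 - α)
            * Real.exp (-(δ * min ((geomT D).dist ⟨p, hpD⟩ ⟨q, hqD⟩) ((geomT D').dist ⟨p, hpD'⟩ ⟨q, hqD'⟩))) * B :=
          add_le_add (mul_le_mul_of_nonneg_right (mul_le_mul_of_nonneg_left hw₁ (by positivity)) hB)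
            (mul_le_mul_of_nonneg_right (mul_le_mul_of_nonneg_left hw₂ (by positivity)) hB)
      _ = _ := by ring
  -- THE RESOLVENT BOUND through the difference functional of `G′[D]`
  have hS₁ : ∀ i : Fin (d + 1), HasMajorant (g := geomT D) (blkOf D.toDomains)
      (Matrix.toLin' (dT (N0 ℓ Mh k P) i * G))
      (fun y y' => C₂ * ((ℓ : ℝ) + 1) ^ y.1.1 * Real.exp (-(δ * (geomT D).dist y y'))) := fun i =>
    hasMajorant_rate_mono D hMh1 hP (fun y => C₂ * ((ℓ : ℝ) + 1) ^ y.1.1) (fun y => by positivity) hδ2' (hS i)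
  have hψ : ∀ (b : ↥(bset D.toDomains)) (u : ↥(boxDom (N0 ℓ Mh k P)) → ℝ) (Bu : ℝ),
      BlockSupp (g := geomT D) (blkOf D.toDomains) u b Bu →
      |diffFun (N0 ℓ Mh k P) G x x' ((torusSupNorm (N0 ℓ Mh k P) (x'.1 - x.1)) ^ (-α)) u|
        ≤ KL * (((ℓ : ℝ) + 1) ^ k) ^ (1 - α) * ((ℓ : ℝ) + 1) ^ k * Real.exp (-(δ * (geomT D).dist ⟨p, hpD⟩ b))
          * Bu := by
    intro b u Bu hu
    rw [hKL]
    exact abs_diffFun_le D hMh1 hP4 hC₂.le hS₁ hα1 hpD hp hne hx hx' b u Bu hu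
  have hR₁ := hasMajorant_rate_mono D' hMh1 hP (fun y => C₃ * ((ℓ : ℝ) + 1) ^ y.1.1) (fun y => by positivity) hδ3' hTm
  have hR₂ : HasMajorant (g := geomT D') (blkOf D'.toDomains) (Matrix.toLin' (gmlT (N0 ℓ Mh k P) ℓ k D'.lev a' * E))
      (fun y y' => C₃ * ((ℓ : ℝ) + 1) ^ (1 * y.1.1) * Real.exp (-(δ * (geomT D').dist y y'))) := by
    rw [← hG']
    exact hasMajorant_of_eq D' hR₁ fun y y' => by rw [one_mul]
  have hres := fun_resolvent_bound D D' hMh1 hP hRMone ha'0 ha'p 1 E hC₃.le hδpos.le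
    (diffFun (N0 ℓ Mh k P) G x x' ((torusSupNorm (N0 ℓ Mh k P) (x'.1 - x.1)) ^ (-α))) (y := ⟨p, hpD⟩) hp
    (by positivity : 0 ≤ KL * (((ℓ : ℝ) + 1) ^ k) ^ (1 - α) * ((ℓ : ℝ) + 1) ^ k) hψ hR₂ (h261f D) hthr
    (y' := ⟨q, hqD'⟩) hq (blockSupp_transfer D D' hqD hqD' hlam)
  rw [← hG', ← hKR] at hres
  -- identify the functional value with the Hölder quotient of the difference
  have hval : diffFun (N0 ℓ Mh k P) G x x' ((torusSupNorm (N0 ℓ Mh k P) (x'.1 - x.1)) ^ (-α))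
        (diffM D D' a' *ᵥ ((G' * E) *ᵥ lam))
      = (torusSupNorm (N0 ℓ Mh k P) (x'.1 - x.1)) ^ (-α)
        * (((G * E - G' * E) *ᵥ lam) x' - ((G * E - G' * E) *ᵥ lam) x) := by
    rw [diffFun_apply, hsub]
    simp only [Matrix.mulVec_mulVec, Matrix.mul_assoc]
  rw [hval, abs_mul, abs_of_nonneg hc0] at hres
  -- `KL·(L^k)^{1−α}·L^k · (L^k/L^{2k}) = KL·(L^k)^{1−α}`
  have hpowid : ((ℓ : ℝ) + 1) ^ k * (((ℓ : ℝ) + 1) ^ (1 * k) / ((ℓ : ℝ) + 1) ^ (2 * k)) = 1 := by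
    rw [one_mul, ← mul_div_assoc, ← pow_add, ← two_mul, div_self (by positivity)]
  have h2 : (torusSupNorm (N0 ℓ Mh k P) (x'.1 - x.1)) ^ (-α)
        * |((G * E - G' * E) *ᵥ lam) x' - ((G * E - G' * E) *ᵥ lam) x|
      ≤ KL * KR * ((((ℓ : ℝ) + 1) ^ k) ^ (1 - α) * B) * Real.exp (-(1 / 2 * δ * dOmega D D' p.2 q.2)) := by
    calc _ ≤ _ := hres
      _ = KL * KR * ((((ℓ : ℝ) + 1) ^ k) ^ (1 - α) * B) * Real.exp (-(1 / 2 * δ * dOmega D D' p.2 q.2))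
            * (((ℓ : ℝ) + 1) ^ k * (((ℓ : ℝ) + 1) ^ (1 * k) / ((ℓ : ℝ) + 1) ^ (2 * k))) := by ring
      _ = _ := by rw [hpowid, mul_one]
  -- both factors at once
  have hfin := combined_bound (by positivity : (0 : ℝ) ≤ 2 * C₅) (by positivity : 0 ≤ KL * KR) (by positivity) htriv h2
  have hw3 : Real.exp (-(1 / 2 * δ * min ((geomT D).dist ⟨p, hpD⟩ ⟨q, hqD⟩) ((geomT D').dist ⟨p, hpD'⟩ ⟨q, hqD'⟩)))
      ≤ Real.exp (-(1 / 4 * δ * min ((geomT D).dist ⟨p, hpD⟩ ⟨q, hqD⟩) ((geomT D').dist ⟨p, hpD'⟩ ⟨q, hqD'⟩))) :=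
    Real.exp_le_exp.2 (by nlinarith)
  have hsq : Real.sqrt (2 * C₅) * Real.sqrt (KL * KR) ≤ Real.sqrt (2 * C₅) * Real.sqrt (KL * KR) + 1 := by linarith
  calc _ ≤ _ := hfin
    _ ≤ (Real.sqrt (2 * C₅) * Real.sqrt (KL * KR) + 1) * ((((ℓ : ℝ) + 1) ^ k) ^ (1 - α) * B)
          * Real.exp (-(1 / 4 * δ * min ((geomT D).dist ⟨p, hpD⟩ ⟨q, hqD⟩) ((geomT D').dist ⟨p, hpD'⟩ ⟨q, hqD'⟩)))
          * Real.exp (-(1 / 4 * δ * dOmega D D' p.2 q.2)) := by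
        refine mul_le_mul_of_nonneg_right ?_ (Real.exp_pos _).le
        exact mul_le_mul (mul_le_mul_of_nonneg_right hsq (by positivity)) hw3 (Real.exp_pos _).le (by positivity)
    _ = _ := by ring

end DualHolder

end

end Literature.MathematicalPhysics.QuantumFieldTheory.Balaban1983to89.B9Thm314GpFlatDualHolder
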